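/-
Copyright: see repository. [cite: CossartPiltant2008, Section 9, Lemma 9.4 (HAL p. 29 l. 48–59)]
-/
import Literature.AlgebraicGeometry.CossartPiltant200819.InvariantRingLocalModel2008

/-!
# Cossart–Piltant 2008, Lemma 9.4 — node N2 carved: the monomial chart is a commutative-algebra
  leaf plus PROVED equivariant bookkeeping

[CP-I] V. Cossart, O. Piltant, *Resolution of singularities of threefolds in positive
characteristic. I.*, J. Algebra **320** (2008) 1051–1082, HAL hal-00139124 (page/line locators
"HAL p. N l. M" refer to the HAL version, as in the rest of this directory).

`TamePrimeDescentNodes2008` carved the proof of Lemma 9.4 (HAL p. 29 l. 14–65) into two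
hypothesis-only nodes; `InvariantRingLocalModel2008` PROVED node N1.  This file carves the
remaining node N2 `MonomialChartRegular` (l. 48–59: "`S₁ := S̄_{m_W ∩ S̄}` is a local model of `W`
and `S₁` is regular by (b) … there exist `γ₂, γ₃ ∈ R₁` such that `S₁` has r.s.p.
`(z₁ := y₁, z₂ := y₂ − γ₂, z₃ := y₃ − γ₃)` satisfying `g.z₁ = ζ^t z₁, g.z₂ = z₂, g.z₃ = z₃`") into

* a **`G`-free leaf** `MonomialChartCentre` (HYPOTHESIS — the commutative algebra of l. 48–49
  and l. 55–56): for a regular local model `S` of `W` with r.s.p. `x`, a unimodular `V` with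
  `V⁻¹ = C ≥ 0` and `y := x^V ⊆ W`, and ANY set of coefficients `F ⊆ S` mapping onto `κ(S)`,
  the maximal ideal of the pinned chart `S₁ := (S[y])_{m_W ∩ S[y]}` is generated by the `y_i`
  of positive value together with `d - #{i | W(y_i) > 0}` values `P_j(y_{I₀})`
  (`I₀ = {i | W(y_i) = 0}`) of polynomials `P_j ∈ S[Y_{I₀}]` with coefficients in `F` — on
  paper: `m_S ⊆ (y_{I₊})S[y]` by (b) (`x = y^C`, `C ≥ 0`), so `S₁/(y_{I₊})S₁` is a localisation
  of a quotient of `κ(S)[Y_{I₀}]` at the centre `𝔫` of `W`, a maximal ideal since `κ(W)/k` is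
  algebraic, whose `#I₀` generators lift through `F ↠ κ(S)` ("`κ(R₁) = κ(S₁)`, so that there
  exist `γ₂, γ₃ ∈ R₁ …`");
* the **PROVED glue** `monomialChartRegular_of_centre : MonomialChartCentre → MonomialChartRegular`
  (everything equivariant in l. 48–59): `S₁` is a local model of `W` containing `S` and `y`
  (`isLocalModelOf_locModel_sup_adjoin`, via the idempotence `locModel_locModel_le`); `S₁` is
  `G`-stable (`g.y_{i₀} ∈ S·y_{i₀}`, `g.y_i = y_i` for `i ≠ i₀`, `g.W = W`); with `F := S ∩ L^G`
  (which maps onto `κ(S)` by the Reynolds average, `exists_fixed_valuation_sub_lt_of_stable`,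
  E376) the generators `P_j(y_{I₀})` are `G`-invariant (`I₀ ⊆ {i ≠ i₀}` as `W(y_{i₀}) > 0`);
  `dim S₁ = d` (`ringKrullDim_eq_of_isLocalModelOf`, E403, twice); and `S₁` is regular because
  its maximal ideal is generated by `d = dim S₁` elements
  (Mathlib `IsRegularLocalRing.of_spanFinrank_maximalIdeal_le`).

Re-threading (PROVED): `tamePrimeDescentViaStableModelRoots_of_centre :
MonomialChartCentre → TamePrimeDescentViaStableModelRoots` and the summit-facing
`cp2008_of_printedLeaves_residuals_centre`.  After this file the leaf
`TamePrimeDescentViaStableModelRoots` of Lemma 9.4 rests on the single `G`-free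
commutative-algebra statement `MonomialChartCentre` (HAL p. 29 l. 48–49 with property (b)): the
Galois theory, the invariant ring `S₁^G` (node N1), the `G`-stability, the dimension count and the
regularity of the chart are all PROVED.

[cite: CossartPiltant2008, Section 9, Lemma 9.4 (HAL p. 29 l. 48–59)]
-/

namespace Literature.AlgebraicGeometry.CossartPiltant200819.CP2008

open Literature.AlgebraicGeometry.Resolution IsLocalRing
open scoped Pointwise

universe u

/-! ## The local ring of `W` on `S[y]` -/

section LocModel

variable {k L : Type u} [Field k] [Field L] [Algebra k L] (W : ValuationSubring L)

/-- Idempotence of `B ↦ B_{m_W ∩ B}`: `(B_{m_W ∩ B})_{m_W ∩ B_{m_W ∩ B}} ⊆ B_{m_W ∩ B}` (a fraction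
of fractions `(b₁/s₁)/(b₂/s₂)` with `W(s₁) = W(s₂) = W(b₂/s₂) = 0` is `b₁s₂/(s₁b₂)` with
`W(s₁b₂) = 0`); cf. Cossart–Piltant 2008, §3 (HAL p. 4), local rings `A_𝔭` of `W` on models.
[cite: CossartPiltant2008, Section 3 (HAL p. 4, local rings and models)] -/
theorem locModel_locModel_le (B : Subalgebra k L) : locModel W (locModel W B) ≤ locModel W B := by
  rintro x ⟨b, hb, t, ht, hvt, rfl⟩
  obtain ⟨b₁, hb₁, s₁, hs₁, hvs₁, rfl⟩ := hb
  obtain ⟨b₂, hb₂, s₂, hs₂, hvs₂, rfl⟩ := ht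
  have hvb₂ : W.valuation b₂ = 1 := by
    have h := hvt
    rw [map_mul, map_inv₀, hvs₂, inv_one, mul_one] at h
    exact h
  refine ⟨b₁ * s₂, B.mul_mem hb₁ hs₂, s₁ * b₂, B.mul_mem hs₁ hb₂,
    by rw [map_mul, hvs₁, hvb₂, mul_one], ?_⟩
  rw [mul_inv, mul_inv, inv_inv]
  ring

/-- For a local model `S` of `W` (with `k ⊆ W`) and finitely many `y_i ∈ W`, the local ring of
`W` on `S̄ := S[y]`, `S₁ := S̄_{m_W ∩ S̄}`, is again a local model of `W` (Cossart–Piltant 2008,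
HAL p. 29 l. 48: "By (c), `S₁ := S̄_{m_W ∩ S̄}` is a local model of `W`"): if `S = A_{m_W ∩ A}` for
an affine model `A`, then `S₁ = (A[y])_{m_W ∩ A[y]}`.
[cite: CossartPiltant2008, Section 9, Lemma 9.4 (HAL p. 29 l. 48)] -/
theorem isLocalModelOf_locModel_sup_adjoin (hk : ∀ c : k, algebraMap k L c ∈ W)
    {S : Subalgebra k L} (hS : IsLocalModelOf k L W S) {T : Set L} (hT : T.Finite)
    (hTW : T ⊆ W) : IsLocalModelOf k L W (locModel W (S ⊔ Algebra.adjoin k T)) := by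
  classical
  obtain ⟨A, hAfg, hAfr, hAW, rfl⟩ := hS.exists_eq_locModel
  haveI := hAfr
  have hA₁fg : (A ⊔ Algebra.adjoin k T).FG :=
    hAfg.sup ⟨hT.toFinset, by rw [hT.coe_toFinset]⟩
  haveI : IsFractionRing ↥(A ⊔ Algebra.adjoin k T) L := isFractionRing_of_le le_sup_left hAfr
  have hTW' : T ⊆ (valuationSubalgebra W hk : Set L) := fun t ht => hTW ht
  have hA₁W : A ⊔ Algebra.adjoin k T ≤ valuationSubalgebra W hk :=
    sup_le (fun a ha => hAW a ha) (Algebra.adjoin_le hTW')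
  have hA₁W' : (A ⊔ Algebra.adjoin k T).toSubring ≤ W.toSubring := fun a ha => hA₁W ha
  have heq : locModel W (locModel W A ⊔ Algebra.adjoin k T) = locModel W (A ⊔ Algebra.adjoin k T) := by
    refine le_antisymm ?_ (locModel_mono W (sup_le_sup_right (le_locModel W A) _))
    refine (locModel_mono W (sup_le (locModel_mono W le_sup_left) ?_)).trans
      (locModel_locModel_le W _)
    exact Algebra.adjoin_le fun t ht =>
      le_locModel W _ ((le_sup_right : Algebra.adjoin k T ≤ A ⊔ Algebra.adjoin k T)
        (Algebra.subset_adjoin ht))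
  rw [heq]
  exact isLocalModelOf_locModel W hA₁fg hA₁W'

end LocModel


/-! ## The leaf: the centre of `W` on the monomial chart (HAL p. 29 l. 48–49, l. 55–56) -/

section

/-- **Node N2a (hypothesis-only leaf; the commutative algebra of Cossart–Piltant 2008, Lemma 9.4,
HAL p. 29 l. 48–49 and l. 55–56, with property (b) of l. 28).**  Quoting l. 48–49: "`S̄ :=
S[y₁, y₂, y₃]`.  By (c), `S₁ := S̄_{m_W ∩ S̄}` is a local model of `W` and `S₁` is regular by (b)",
and l. 55–56: "`κ(R₁) = κ(S₁)`, so that there exist `γ₂, γ₃ ∈ R₁` such that `S₁` has r.s.p.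
`(z₁ := y₁, z₂ := y₂ − γ₂, z₃ := y₃ − γ₃)`".

Typed `G`-free content.  Setting: `W` a valuation ring of `L/k` (`k ⊆ W`, `κ(W)/k` algebraic),
`S` a regular local model of `W` with regular system of parameters `x₁, …, x_d ∈ S`
(`(x) = m_S`, `d = dim S`), `V ∈ GL_d(ℤ)` with inverse `C` having non-negative entries
(property (b): `ℕ^d ⊆ Σ ℕ v_i`), `y_i := ∏_j x_j^{v_{ij}} ∈ W` (property (c)), and a set of
coefficients `F ⊆ S` mapping onto the residue field `κ(S)` (`∀ c ∈ S, ∃ c' ∈ F, c − c' ∈ m_W`;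
in the paper `F = R₁ = S₁^G`, "`κ(R₁) = κ(S₁)`"; in the glue below `F = S ∩ L^G`).
Conclusion, for the PINNED chart `S₁ := S̄_{m_W ∩ S̄}`, `S̄ := S[y] = S ⊔ k[y]`
(`locModel W (S ⊔ Algebra.adjoin k (Set.range y))`), with `I₊ := {i | W(y_i) > 0}` and
`I₀ := {i | W(y_i) = 0}`: `S₁` is local and there are `m` polynomials
`P_j ∈ S[Y_i : i ∈ I₀]` whose (non-zero) coefficients lie in `F`, `#I₊ + m = d`, such that
`m_{S₁} = (y_i : i ∈ I₊) + (P_j(y_{I₀}) : j)`.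

Proof on paper (NOT formalised here — this is the hypothesis; it is where (b) enters): every
`x_j = ∏_i y_i^{c_{ji}}` (`C = V⁻¹ ≥ 0`) has `W(x_j) > 0`, hence involves some `y_i` with `i ∈ I₊`,
so `m_S ⊆ (y_{I₊})S̄` and `S̄/(y_{I₊})S̄` is a quotient of `κ(S)[Y_{I₀}]`; localising,
`S₁/(y_{I₊})S₁ ≅ (κ(S)[Y_{I₀}]/𝔠)_𝔫` with `𝔫 ⊇ 𝔠` the kernel of `Y_i ↦ ȳ_i ∈ κ(W)`; as
`κ(W)/k` is algebraic, `κ(S)[ȳ_{I₀}] ⊆ κ(W)` is a field, so `𝔫` is a maximal ideal of the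
polynomial ring `κ(S)[Y_{I₀}]`, generated by `m := #I₀` polynomials `P̄_j`; lifting their
coefficients through `F ↠ κ(S)` gives `P_j` with `m_{S₁} = (y_{I₊}) + (P_j(y_{I₀}))`.  (The
paper phrases the outcome as "`S₁` is regular by (b)" with r.s.p. `(y₁, y₂ − γ₂, y₃ − γ₃)`;
regularity itself is DERIVED in the glue from `#generators = d = dim S₁`.)  Mathlib has regular
local rings (`Mathlib.RingTheory.RegularLocalRing`) and `MvPolynomial`, but the computation of
the special fibre of the monomial chart is not available.
[cite: CossartPiltant2008, Section 9, Lemma 9.4 (HAL p. 29 l. 48–49, 55–56)] -/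
def MonomialChartCentre : Prop :=
  ∀ (k L : Type u) [Field k] [Field L] [Algebra k L]
    (W : ValuationSubring L) (hk : ∀ c : k, algebraMap k L c ∈ W), residueTrdeg k W hk = 0 →
    ∀ (S : Subalgebra k L) [IsRegularLocalRing S], IsLocalModelOf k L W S →
    ∀ (d : ℕ) (x : Fin d → L), (∀ j, x j ∈ S) →
      Ideal.span {s : S | (s : L) ∈ Set.range x} = maximalIdeal S → ringKrullDim S = d →
    ∀ (V C : Matrix (Fin d) (Fin d) ℤ), V * C = 1 → (∀ i j, 0 ≤ C i j) →
    ∀ (y : Fin d → L), (∀ i, y i = ∏ j, x j ^ V i j) → (∀ i, y i ∈ W) →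
    ∀ (F : Set L), F ⊆ S → (∀ c ∈ S, ∃ c' ∈ F, W.valuation (c - c') < 1) →
      ∃ (m : ℕ) (P : Fin m → MvPolynomial {i : Fin d // W.valuation (y i) = 1} S)
        (_ : IsLocalRing (locModel W (S ⊔ Algebra.adjoin k (Set.range y)))),
        (∀ j, ∀ n ∈ (P j).support, (((P j).coeff n : S) : L) ∈ F) ∧
        Fintype.card {i : Fin d // W.valuation (y i) < 1} + m = d ∧
        Ideal.span {s : locModel W (S ⊔ Algebra.adjoin k (Set.range y)) |
            (s : L) ∈ y '' {i | W.valuation (y i) < 1} ∪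
              Set.range (fun j => MvPolynomial.aeval
                (fun i : {i : Fin d // W.valuation (y i) = 1} => y i.1) (P j))} =
          maximalIdeal (locModel W (S ⊔ Algebra.adjoin k (Set.range y)))

end

/-! ## PROVED glue: node N2 from the leaf -/

section Stability

variable {k K L : Type u} [Field k] [Field K] [Field L] [Algebra K L] [Algebra k L]

/-- `G`-stability of the chart `S₁ = S̄_{m_W ∩ S̄}`, `S̄ = S[y]` (Cossart–Piltant 2008, HAL p. 29
l. 48–50: `S` is `G`-stable, `g.y₁ ∈ S·y₁`, `g.y_i = y_i` (`i ≠ 1`) by (54), and `g.W = W`).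
[cite: CossartPiltant2008, Section 9, Lemma 9.4 (HAL p. 29 l. 48–50)] -/
theorem map_mem_locModel_sup_adjoin [Algebra k K] [IsScalarTower k K L] (W : ValuationSubring L)
    {S : Subalgebra k L} (hstab : ∀ σ : L ≃ₐ[K] L, ∀ s ∈ S, σ s ∈ S) {d : ℕ} {y : Fin d → L} {i₀ : Fin d}
    (hsemi : ∀ σ : L ≃ₐ[K] L, ∃ c ∈ S, σ (y i₀) = c * y i₀)
    (hinv : ∀ σ : L ≃ₐ[K] L, ∀ i, i ≠ i₀ → σ (y i) = y i)
    (σ : L ≃ₐ[K] L) (hσW : σ • W = W) {s : L}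
    (hs : s ∈ locModel W (S ⊔ Algebra.adjoin k (Set.range y))) :
    σ s ∈ locModel W (S ⊔ Algebra.adjoin k (Set.range y)) := by
  have hSS₁ : S ≤ locModel W (S ⊔ Algebra.adjoin k (Set.range y)) :=
    le_sup_left.trans (le_locModel W _)
  have hyS₁ : ∀ i, y i ∈ locModel W (S ⊔ Algebra.adjoin k (Set.range y)) := fun i =>
    le_locModel W _ ((le_sup_right : Algebra.adjoin k (Set.range y) ≤ _)
      (Algebra.subset_adjoin ⟨i, rfl⟩))
  have hB : ∀ b ∈ S ⊔ Algebra.adjoin k (Set.range y),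
      σ b ∈ locModel W (S ⊔ Algebra.adjoin k (Set.range y)) := by
    intro b hb
    have hle : (S ⊔ Algebra.adjoin k (Set.range y)).map (σ.restrictScalars k : L →ₐ[k] L) ≤
        locModel W (S ⊔ Algebra.adjoin k (Set.range y)) := by
      rw [Algebra.map_sup, AlgHom.map_adjoin]
      refine sup_le ?_ (Algebra.adjoin_le ?_)
      · rintro _ ⟨t, ht, rfl⟩
        exact hSS₁ (hstab σ t ht)
      · rintro _ ⟨_, ⟨i, rfl⟩, rfl⟩
        change σ (y i) ∈ _
        by_cases hi : i = i₀
        · subst hi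
          obtain ⟨c, hcS, hc⟩ := hsemi σ
          rw [hc]
          exact Subalgebra.mul_mem _ (hSS₁ hcS) (hyS₁ _)
        · rw [hinv σ i hi]
          exact hyS₁ i
    exact hle (Subalgebra.mem_map.mpr ⟨b, hb, rfl⟩)
  obtain ⟨b, hb, t, ht, hvt, rfl⟩ := hs
  rw [map_mul, map_inv₀]
  exact Subalgebra.mul_mem _ (hB b hb)
    (inv_mem_locModel W _ (hB t ht) ((valuation_map_eq_one_iff W hσW t).mpr hvt))

end Stability

section Counting

variable {L : Type u} [Field L]

/-- Counting the generators: `#{i | W(y_i) > 0, i ≠ i₀} + 1 = #{i | W(y_i) > 0}` for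
`W(y_{i₀}) > 0`. [folklore] -/
private theorem card_subtype_and_ne_add_one {d : ℕ} (p : Fin d → Prop) [DecidablePred p]
    {i₀ : Fin d} (h₀ : p i₀) :
    Fintype.card {i : Fin d // p i ∧ i ≠ i₀} + 1 = Fintype.card {i : Fin d // p i} := by
  classical
  rw [Fintype.card_subtype, Fintype.card_subtype]
  have hmem : i₀ ∈ Finset.univ.filter p := by simpa using h₀
  rw [← Finset.card_erase_add_one hmem]
  congr 2
  ext i
  simp only [Finset.mem_filter, Finset.mem_univ, true_and, Finset.mem_erase]
  exact and_comm

/-- A family indexed by `Fin e` together with one more element has at most `e + 1` members.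
[folklore] -/
private theorem ncard_insert_range_le {α : Type*} {e : ℕ} (a : α) (z : Fin e → α) :
    (insert a (Set.range z)).ncard ≤ e + 1 := by
  refine (Set.ncard_insert_le _ _).trans (Nat.add_le_add_right ?_ 1)
  calc (Set.range z).ncard ≤ (Set.univ : Set (Fin e)).ncard := by
        rw [← Set.image_univ]; exact Set.ncard_image_le Set.finite_univ
    _ = e := by rw [Set.ncard_univ, Nat.card_eq_fintype_card, Fintype.card_fin]

/-- The generating set `{y_{i₀}} ∪ {z_j}` of the glue equals the generating set
`{y_i | W(y_i) > 0} ∪ {q_j}` of the leaf. [folklore] -/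
private theorem insert_range_sum_elim_eq {α : Type*} {d m : ℕ} (y : Fin d → α) (p : Fin d → Prop)
    {i₀ : Fin d} (h₀ : p i₀) (q : Fin m → α) :
    insert (y i₀) (Set.range (Sum.elim (fun i : {i : Fin d // p i ∧ i ≠ i₀} => y i.1) q)) =
      y '' {i | p i} ∪ Set.range q := by
  rw [Set.Sum.elim_range, ← Set.insert_union]
  congr 1
  ext v
  simp only [Set.mem_insert_iff, Set.mem_range, Set.mem_image, Set.mem_setOf_eq,
    Subtype.exists, exists_prop]
  constructor
  · rintro (rfl | ⟨i, ⟨hi, -⟩, rfl⟩)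
    exacts [⟨i₀, h₀, rfl⟩, ⟨i, hi, rfl⟩]
  · rintro ⟨i, hi, rfl⟩
    by_cases hii : i = i₀
    · exact Or.inl (by rw [hii])
    · exact Or.inr ⟨i, ⟨hi, hii⟩, rfl⟩

/-- Reindexing a finite family by `Fin`. [folklore] -/
private theorem exists_fin_range_eq {α ι : Type*} [Fintype ι] (w : ι → α) :
    ∃ z : Fin (Fintype.card ι) → α, Set.range z = Set.range w :=
  ⟨w ∘ (Fintype.equivFin ι).symm, (Fintype.equivFin ι).symm.surjective.range_comp w⟩

/-- `dim = d` read off in `ℕ`. [folklore] -/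
private theorem nat_eq_of_withBot_eq {n d : ℕ} (h : ((n : ℕ∞) : WithBot ℕ∞) = d) : n = d := by
  exact_mod_cast h

/-- A Noetherian local domain `S₁ ⊆ L` of dimension `n` whose maximal ideal is generated by the
elements of a set `T ⊆ L` with `#T ≤ n` is a regular local ring (Mathlib:
`IsRegularLocalRing.of_spanFinrank_maximalIdeal_le`). [folklore] -/
private theorem isRegularLocalRing_of_span_eq {k : Type u} [Field k] [Algebra k L]
    (S₁ : Subalgebra k L) [IsLocalRing S₁] [IsNoetherianRing S₁] {T : Set L} (hT : T.Finite)
    {n : ℕ} (hTn : T.ncard ≤ n) (hdim : ringKrullDim S₁ = n)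
    (hspan : Ideal.span {s : S₁ | (s : L) ∈ T} = maximalIdeal S₁) : IsRegularLocalRing S₁ := by
  refine IsRegularLocalRing.of_spanFinrank_maximalIdeal_le S₁ ?_
  rw [← hspan, hdim]
  have hfin : {s : S₁ | (s : L) ∈ T}.Finite := hT.preimage Subtype.val_injective.injOn
  have h1 : (Ideal.span {s : S₁ | (s : L) ∈ T}).spanFinrank ≤ n := by
    refine (Submodule.spanFinrank_span_le_ncard_of_finite hfin).trans ?_
    rw [← Set.ncard_image_of_injective _ Subtype.val_injective]
    refine (Set.ncard_le_ncard ?_ hT).trans hTn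
    rintro _ ⟨s, hs, rfl⟩
    exact hs
  exact_mod_cast h1

end Counting

/-- **Node N2 `MonomialChartRegular` from the leaf `MonomialChartCentre` (PROVED equivariant
bookkeeping of Cossart–Piltant 2008, Lemma 9.4, HAL p. 29 l. 48–59).**  Given the leaf, for
`S` a `G`-stable regular local model at an inertial `W` (`G = Gal(L/K)`, `[L : K] ≠ 0` in `K`,
`κ(W)/k` algebraic) with r.s.p. `x`, `y = x^V ⊆ W` (`V⁻¹ = C ≥ 0`), `W(y_{i₀}) > 0`,
`g.y_{i₀} ∈ S · y_{i₀}` and `g.y_i = y_i` (`i ≠ i₀`): the chart `S₁ := S̄_{m_W ∩ S̄}` is a `G`-stable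
regular local model of `W` containing `S` and the `y_i`, of dimension `e + 1 = d`, with r.s.p.
`(y_{i₀}, z)` where the `z_j` — the other `y_i` of positive value and the `P_j(y_{I₀})` of the
leaf taken with `G`-INVARIANT coefficients (`F := S ∩ L^G ↠ κ(S)` by the Reynolds average
`exists_fixed_valuation_sub_lt_of_stable`, E376: "`κ(R₁) = κ(S₁)`") — are `G`-invariant
(l. 56–57: "`g.z₁ = ζ^t z₁, g.z₂ = z₂, g.z₃ = z₃`").  Regularity of `S₁`: its maximal ideal is
generated by `d = dim S₁` elements (`dim S₁ = dim S = d`, both local models of `W`, E403).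
[cite: CossartPiltant2008, Section 9, Lemma 9.4 (HAL p. 29 l. 48–59)] -/
theorem monomialChartRegular_of_centre (h : MonomialChartCentre.{u}) :
    MonomialChartRegular.{u} := by
  intro k K _ _ _ L _ _ _ _ hfd hgal hlK W hk hres hin S hSreg hS hstab d x hxS hspanx hdimS V C
    hVC hC y hy hyW i₀ hy₀ hsemi hinv
  classical
  -- inertia, unpacked; `#G ≠ 0` in `L`
  have hin' : ∀ σ : L ≃ₐ[K] L, σ • W = W ∧ ∀ x ∈ W, W.valuation (σ x - x) < 1 := fun σ =>
    (mem_inertiaGroup_iff' W σ).mp ((mem_inertiaGroup_iff W σ).mpr (hin σ))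
  have hcardL : ((Nat.card (L ≃ₐ[K] L) : ℕ) : L) ≠ 0 := by
    rw [IsGalois.card_aut_eq_finrank]
    intro h0
    exact hlK ((algebraMap K L).injective (by rw [map_natCast, h0, map_zero]))
  have hSW : ∀ s ∈ S, s ∈ W := fun s hs => hS.mem_of_mem hs
  -- `F := S ∩ L^G` maps onto `κ(S)` (E376, "`κ(R₁) = κ(S₁)`")
  have hFres : ∀ c ∈ S, ∃ c' ∈ {c : L | c ∈ S ∧ ∀ σ : L ≃ₐ[K] L, σ c = c},
      W.valuation (c - c') < 1 := by
    intro c hc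
    obtain ⟨θ, hθS, hθfix, hθv⟩ :=
      exists_fixed_valuation_sub_lt_of_stable W S hSW hstab hcardL (fun σ => (hin' σ).2) hc
    exact ⟨θ, ⟨hθS, hθfix⟩, hθv⟩
  -- the leaf
  obtain ⟨m, P, hloc, hcoef, hcard, hspan⟩ := h k L W hk hres S hS d x hxS hspanx hdimS V C hVC hC
    y hy hyW {c : L | c ∈ S ∧ ∀ σ : L ≃ₐ[K] L, σ c = c} (fun c hc => hc.1) hFres
  -- the chart `S₁ := S̄_{m_W ∩ S̄}`, `S̄ = S[y]` (l. 48): a local model containing `S` and `y`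
  have hyW' : Set.range y ⊆ (W : Set L) := by
    rintro _ ⟨i, rfl⟩
    exact hyW i
  have hS₁mod : IsLocalModelOf k L W (locModel W (S ⊔ Algebra.adjoin k (Set.range y))) :=
    isLocalModelOf_locModel_sup_adjoin W hk hS (Set.finite_range y) hyW'
  have hSS₁ : S ≤ locModel W (S ⊔ Algebra.adjoin k (Set.range y)) :=
    le_sup_left.trans (le_locModel W _)
  have hyS₁ : ∀ i, y i ∈ locModel W (S ⊔ Algebra.adjoin k (Set.range y)) := fun i =>
    le_locModel W _ ((le_sup_right : Algebra.adjoin k (Set.range y) ≤ _)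
      (Algebra.subset_adjoin ⟨i, rfl⟩))
  -- `S₁` is `G`-stable
  have hstab₁ : ∀ σ : L ≃ₐ[K] L, ∀ s ∈ locModel W (S ⊔ Algebra.adjoin k (Set.range y)),
      σ s ∈ locModel W (S ⊔ Algebra.adjoin k (Set.range y)) := fun σ s hs =>
    map_mem_locModel_sup_adjoin W hstab hsemi hinv σ (hin' σ).1 hs
  -- the invariant generators `q_j := P_j(y_{I₀})` (l. 55–57)
  have hI₀ne : ∀ i : {i : Fin d // W.valuation (y i) = 1}, i.1 ≠ i₀ := fun i hi =>
    hy₀.ne (by rw [← hi]; exact i.2)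
  have hqS₁ : ∀ j, MvPolynomial.aeval (fun i : {i : Fin d // W.valuation (y i) = 1} => y i.1)
      (P j) ∈ locModel W (S ⊔ Algebra.adjoin k (Set.range y)) := fun j => by
    rw [MvPolynomial.aeval_def, MvPolynomial.eval₂_eq]
    refine Subalgebra.sum_mem _ fun n _ => Subalgebra.mul_mem _ (hSS₁ ((P j).coeff n).2) ?_
    exact Subalgebra.prod_mem _ fun i _ => Subalgebra.pow_mem _ (hyS₁ i.1) _
  have hqfix : ∀ (σ : L ≃ₐ[K] L) (j),
      σ (MvPolynomial.aeval (fun i : {i : Fin d // W.valuation (y i) = 1} => y i.1) (P j)) =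
        MvPolynomial.aeval (fun i : {i : Fin d // W.valuation (y i) = 1} => y i.1) (P j) :=
    fun σ j => by
      rw [MvPolynomial.aeval_def, MvPolynomial.eval₂_eq, map_sum]
      refine Finset.sum_congr rfl fun n hn => ?_
      rw [map_mul, map_prod]
      congr 1
      · exact (hcoef j n hn).2 σ
      · exact Finset.prod_congr rfl fun i _ => by rw [map_pow, hinv σ i.1 (hI₀ne i)]
  -- the family `z`: the `y_i` of positive value other than `y_{i₀}`, then the `q_j`
  obtain ⟨z, hz⟩ := exists_fin_range_eq (Sum.elim
    (fun i : {i : Fin d // W.valuation (y i) < 1 ∧ i ≠ i₀} => y i.1) fun j =>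
      MvPolynomial.aeval (fun i : {i : Fin d // W.valuation (y i) = 1} => y i.1) (P j))
  have hzw : ∀ j, z j ∈ Set.range (Sum.elim
      (fun i : {i : Fin d // W.valuation (y i) < 1 ∧ i ≠ i₀} => y i.1) fun j =>
        MvPolynomial.aeval (fun i : {i : Fin d // W.valuation (y i) = 1} => y i.1) (P j)) :=
    fun j => by
      rw [← hz]
      exact Set.mem_range_self j
  have hzS₁ : ∀ j, z j ∈ locModel W (S ⊔ Algebra.adjoin k (Set.range y)) := fun j => by
    obtain ⟨c, hc⟩ := hzw j
    rw [← hc]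
    rcases c with i | j'
    · exact hyS₁ _
    · exact hqS₁ _
  have hzfix : ∀ (σ : L ≃ₐ[K] L) (j), σ (z j) = z j := fun σ j => by
    obtain ⟨c, hc⟩ := hzw j
    rw [← hc]
    rcases c with i | j'
    · exact hinv σ i.1 i.2.2
    · exact hqfix σ j'
  have hset : insert (y i₀) (Set.range z) = y '' {i | W.valuation (y i) < 1} ∪
      Set.range (fun j => MvPolynomial.aeval
        (fun i : {i : Fin d // W.valuation (y i) = 1} => y i.1) (P j)) := by
    rw [hz]
    exact insert_range_sum_elim_eq y (fun i => W.valuation (y i) < 1) hy₀ _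
  have hspan₁ : Ideal.span {s : locModel W (S ⊔ Algebra.adjoin k (Set.range y)) |
      (s : L) ∈ insert (y i₀) (Set.range z)} =
        maximalIdeal (locModel W (S ⊔ Algebra.adjoin k (Set.range y))) := by
    rw [hset]
    exact hspan
  -- `dim S₁ = dim S = d` (E403 twice) and `e + 1 = d`
  obtain ⟨A, hAfg, hAfr, -⟩ := hS.exists_affine_le
  haveI := hAfr
  haveI : Algebra.FiniteType k A := A.fg_iff_finiteType.mp hAfg
  obtain ⟨n, -, hn⟩ := exists_ringKrullDim_eq_and_trdeg_eq k A
  have htr : Algebra.trdeg k L = n := by rw [trdeg_eq_trdeg_of_isFractionRing A, hn]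
  have hnd : n = d := by
    have h1 : ringKrullDim S = n := ringKrullDim_eq_of_isLocalModelOf W hk hres htr hS
    rw [hdimS] at h1
    exact nat_eq_of_withBot_eq h1.symm
  have hdimS₁ : ringKrullDim (locModel W (S ⊔ Algebra.adjoin k (Set.range y))) = d := by
    have h1 := ringKrullDim_eq_of_isLocalModelOf W hk hres htr hS₁mod
    rw [hnd] at h1
    exact h1
  have hed : Fintype.card ({i : Fin d // W.valuation (y i) < 1 ∧ i ≠ i₀} ⊕ Fin m) + 1 = d := by
    have h1 := card_subtype_and_ne_add_one (fun i => W.valuation (y i) < 1) hy₀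
    rw [Fintype.card_sum, Fintype.card_fin]
    omega
  -- regularity: `m_{S₁}` is generated by `≤ e + 1 = d = dim S₁` elements
  haveI : IsNoetherianRing (locModel W (S ⊔ Algebra.adjoin k (Set.range y))) :=
    hS₁mod.isNoetherianRing
  have hreg : IsRegularLocalRing (locModel W (S ⊔ Algebra.adjoin k (Set.range y))) :=
    isRegularLocalRing_of_span_eq _ ((Set.finite_range z).insert _)
      ((ncard_insert_range_le (y i₀) z).trans hed.le) hdimS₁ hspan₁
  refine ⟨locModel W (S ⊔ Algebra.adjoin k (Set.range y)), hreg, hS₁mod, hSS₁, hyS₁, hstab₁,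
    _, z, hzS₁, hzfix, hspan₁, ?_⟩
  rw [hed]
  exact hdimS₁

/-! ## Re-threading: the Roots leaf and the directory's dependency statements through the
`G`-free leaf -/

section Rethreaded

/-- **The Roots leaf of Lemma 9.4 from the single `G`-free leaf `MonomialChartCentre`**
(`tamePrimeDescentViaStableModelRoots_of_monomialChart` ∘ `monomialChartRegular_of_centre`; node
N1 is PROVED in `InvariantRingLocalModel2008`).
[cite: CossartPiltant2008, Lemma 9.4 proof (HAL p. 29, l. 14–65)] -/
theorem tamePrimeDescentViaStableModelRoots_of_centre (h : MonomialChartCentre.{u}) :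
    TamePrimeDescentViaStableModelRoots.{u} :=
  tamePrimeDescentViaStableModelRoots_of_monomialChart (monomialChartRegular_of_centre h)

/-- **Lemma 9.4 from Cor. 6.3, Prop. 9.3, the `G`-free monomial-chart leaf and (S3\*) for
inertial `W`** (`tamePrimeDescent_of_monomialChart_of_inertia` with N2 reduced to N2a).
[cite: CossartPiltant2008, Lemma 9.4 (HAL pp. 28–29)] -/
theorem tamePrimeDescent_of_centre_of_inertia (h63 : ClimbToInertiaField.{u})
    (h93 : DescentBelowInertiaField.{u}) (n : MonomialChartCentre.{u})
    (h₂ : GStableUniformizationInertial.{u}) : TamePrimeDescent.{u} :=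
  tamePrimeDescent_of_monomialChart_of_inertia h63 h93 (monomialChartRegular_of_centre n) h₂

/-- **[CP-I] Thm. 2.1 VERBATIM for reduced quasi-projective threefolds —
`resolutionQuasiProjectiveThreefolds_of_printedLeaves_residuals_monomialChart` with node N2
reduced to the `G`-free leaf.**
[cite: CossartPiltant2008, Thm 2.1 (HAL p. 3)] [cite: CossartPiltant2009, Theorem (p. 1839)]
[cite: CossartJannsenSaito2020, Introduction Thm. 1, Thm. 1.2] -/
theorem resolutionQuasiProjectiveThreefolds_of_printedLeaves_residuals_centre
    (h49 : RefinedPatchingQuasiProjective.{u}) (hP : CossartPiltant2019Principalization.{u})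
    (h83 : PrimeDegreeAscent.{u}) (h93 : DescentBelowInertiaField.{u})
    (n : MonomialChartCentre.{u})
    (hFu : PrimaryTransformRankOne.{u}) (hBPR : BenitoPiltantReguera2022QuadraticSequence.{u})
    (hnd : GStableUniformizationInertialRankOneNonDiscrete.{u})
    (hdi : GStableUniformizationInertialRankOneDiscreteImperfect.{u})
    (cp2 : CossartPiltant2009Main.{u}) (hE : CossartJannsenSaito2020Embedded.{u})
    (h36 : CossartJannsenSaito2020Sequence.{u}) : ResolutionQuasiProjectiveThreefolds.{u} :=
  resolutionQuasiProjectiveThreefolds_of_printedLeaves_residuals_monomialChart h49 hP h83 h93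
    (monomialChartRegular_of_centre n) hFu hBPR hnd hdi cp2 hE h36

/-- **Both halves of the 2008 programme's top statement —
`cp2008_of_printedLeaves_residuals_monomialChart` with node N2 reduced to the `G`-free leaf.**
[cite: CossartPiltant2008, Thm 2.1 and Thm 7.2 (HAL pp. 3–4)] [cite: CossartPiltant2009, Theorem (p. 1839)]
[cite: CossartJannsenSaito2020, Thm. 1.2] -/
theorem cp2008_of_printedLeaves_residuals_centre (p49 : RefinedPatching.{u})
    (hP : CossartPiltant2019Principalization.{u}) (h83 : PrimeDegreeAscent.{u})
    (h93 : DescentBelowInertiaField.{u}) (n : MonomialChartCentre.{u})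
    (hFu : PrimaryTransformRankOne.{u})
    (hBPR : BenitoPiltantReguera2022QuadraticSequence.{u})
    (hnd : GStableUniformizationInertialRankOneNonDiscrete.{u})
    (hdi : GStableUniformizationInertialRankOneDiscreteImperfect.{u})
    (cp2 : CossartPiltant2009Main.{u}) (h36 : CossartJannsenSaito2020General.{u})
    (p41 : CossartJannsenSaito2020Embedded.{u}) :
    ResolutionAffineThreefolds.{u} ∧ LU3DiffFinite.{u} :=
  cp2008_of_printedLeaves_residuals_monomialChart p49 hP h83 h93 (monomialChartRegular_of_centre n)
    hFu hBPR hnd hdi cp2 h36 p41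

/-- **[CP-I] Thm. 2.1 in universe `0` with the discrete-imperfect residual reduced to its core via
Knaf–Kuhlmann — `resolutionQuasiProjectiveThreefolds_of_printedLeaves_residuals₀_monomialChart`
with node N2 reduced to the `G`-free leaf.**
[cite: CossartPiltant2008, Thm 2.1 (HAL p. 3)] [cite: KnafKuhlmann2009, Thm. 1.5]
[cite: CossartJannsenSaito2020, Introduction Thm. 1, Thm. 1.2] -/
theorem resolutionQuasiProjectiveThreefolds_of_printedLeaves_residuals₀_centre
    (h49 : RefinedPatchingQuasiProjective.{0}) (hP : CossartPiltant2019Principalization.{0})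
    (h83 : PrimeDegreeAscent.{0}) (h93 : DescentBelowInertiaField.{0})
    (n : MonomialChartCentre.{0})
    (hFu : PrimaryTransformRankOne.{0}) (hKK : KnafKuhlmann2009MonogenicCompletion)
    (hBPR : BenitoPiltantReguera2022QuadraticSequence.{0})
    (hnd : GStableUniformizationInertialRankOneNonDiscrete.{0})
    (hdic : GStableUniformizationInertialRankOneDiscreteImperfectCore)
    (cp2 : CossartPiltant2009Main.{0}) (hE : CossartJannsenSaito2020Embedded.{0})
    (h36 : CossartJannsenSaito2020Sequence.{0}) : ResolutionQuasiProjectiveThreefolds.{0} :=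
  resolutionQuasiProjectiveThreefolds_of_printedLeaves_residuals₀_monomialChart h49 hP h83 h93
    (monomialChartRegular_of_centre n) hFu hKK hBPR hnd hdic cp2 hE h36

end Rethreaded

end Literature.AlgebraicGeometry.CossartPiltant200819.CP2008
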